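import Summits.Ventures.CertifiedManyBodySolver.Theorems.TcThermcert1SaddleLocal
import Summits.Ventures.CertifiedManyBodySolver.Theorems.TcThermcert1SaddleGlobal
import Mathlib
import HarnessLib

/-!
# Saddle geometry on the fugacity torus, part 9: assembly of K3b (`stub_saddleGeometry`)

Helper file for route `TcThermcert1`, crux `ThermalStiffnessCeilingU8b10_le_1o8` (item `stmt-Ventures-26381`), line
`Cruxes/ThermalStiffnessCeilingU8b10_le_1o8/Lines/zerofree_corridor.lean` v8, registered stub `stub_saddleGeometry` (K3b); step S9 of
`Cruxes/ThermalStiffnessCeilingU8b10_le_1o8/STUB-PLAN-stub_saddleGeometry.md`.  This file PROVES the stub's statement (with the line-local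
abbreviation `fugAnnulus = {2/3 < |ζ| < 8/9}` spelled out), so that line v9 may set `stub_saddleGeometry := saddle_geometry` and K3
`stub_largePowersSaddle2D` becomes a theorem via the already-proved composition `largePowersSaddle2D_of`.

Assembly (constants `ρ = 10⁻⁶`, `s = 1/20`, `S = 1/5`, `K = 16501`, `γ = ρ²/200`, `ε₁ = min(τ₀/412, ρ²/1000)`, `M₁ = 300`):
targets `α = a/M`, `β = b/M` are within `1/300` of `7/16` (`abs_target_sub_le`); part 5 gives the base point `(z₀, w₀)` solving the
perturbed saddle equations, `111ε₁`-close to the real saddle; in polar form `z₀ = r₁e^{iφ₀}` (`r₁ = ‖z₀‖ ∈ [13/18, 15/18]`,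
`φ₀ = arg z₀`, `|φ₀| ≤ 250ε₁` by Jordan's inequality `abs_arg_le_of_re_nonneg` / `abs_arg_le_of_near_real`); part 2 gives the continuous
exponent `Φ` and clause (i); part 7 (`saddle_local_bounds`, after rewriting `r₁e^{i(φ₀+u)} = z₀e^{iu}`) gives clause (ii); part 8
(`saddle_global_bound`) gives clause (iii) since `15(φ₀²+ψ₀²) + 2ε₁ ≤ ρ²/200`.

* `saddle_geometry_core` — the statement with the explicit constants;  * `saddle_geometry` — K3b verbatim (annulus spelled out).

[folklore: Laplace/saddle-point method for large powers with a small analytic perturbation, two variables, complex critical point;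
de Bruijn 1958 ch. 4–5, FlajoletSedgewick2009 Thm VIII.8, PemantleWilson2013 ch. 5] No definitions; no `sorry`.
-/

noncomputable section

open Complex Metric Set

namespace Summit.Ventures.CertifiedManyBodySolver.Theorems.TcThermcert1.ZeroFreeCorridor

/-! ## §10 Assembly of K3b -/

/-- Jordan's inequality for the argument: in the closed right half plane `|arg z| ≤ (π/2) · |Im z| / ‖z‖`. -/
theorem abs_arg_le_of_re_nonneg {z : ℂ} (hz : 0 ≤ z.re) : |arg z| ≤ Real.pi / 2 * (|z.im| / ‖z‖) := by
  have hφ : |arg z| ≤ Real.pi / 2 := Complex.abs_arg_le_pi_div_two_iff.mpr hz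
  have hpi := Real.pi_pos
  obtain ⟨hφ1, hφ2⟩ := abs_le.mp hφ
  have hj := Real.mul_le_sin (abs_nonneg (arg z)) hφ
  have hsa : Real.sin |arg z| = |Real.sin (arg z)| := by
    rcases le_total 0 (arg z) with h0 | h0
    · rw [abs_of_nonneg h0, abs_of_nonneg (Real.sin_nonneg_of_nonneg_of_le_pi h0 (by linarith))]
    · have hs : 0 ≤ Real.sin (-arg z) := Real.sin_nonneg_of_nonneg_of_le_pi (by linarith) (by linarith)
      rw [Real.sin_neg] at hs
      rw [abs_of_nonpos h0, Real.sin_neg, abs_of_nonpos (by linarith)]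
  rw [hsa, Complex.sin_arg, abs_div, abs_norm] at hj
  calc |arg z| = Real.pi / 2 * (2 / Real.pi * |arg z|) := by field_simp
    _ ≤ Real.pi / 2 * (|z.im| / ‖z‖) := mul_le_mul_of_nonneg_left hj (by positivity)

/-- The base point is almost real: `‖z − x‖ ≤ 111ε` with `x ≥ 1/100` real and `13/18 ≤ ‖z‖`, `ε ≤ 1/28000`, give
`|arg z| ≤ 250ε`. -/
theorem abs_arg_le_of_near_real {z : ℂ} {x ε : ℝ} (hx : 1 / 100 ≤ x) (hε : ε ≤ 1 / 28000) (hz : 13 / 18 ≤ ‖z‖)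
    (hzx : ‖z - (x : ℂ)‖ ≤ 111 * ε) : |arg z| ≤ 250 * ε := by
  have him : |z.im| ≤ 111 * ε := by
    have := (Complex.abs_im_le_norm (z - (x : ℂ))).trans hzx
    rwa [Complex.sub_im, Complex.ofReal_im, sub_zero] at this
  have hre : 0 ≤ z.re := by
    have := (Complex.abs_re_le_norm (z - (x : ℂ))).trans hzx
    rw [Complex.sub_re, Complex.ofReal_re] at this
    have := (abs_le.mp this).1
    linarith
  have hn0 : 0 < ‖z‖ := by linarith
  have h1 := abs_arg_le_of_re_nonneg hre
  have h2 : |z.im| / ‖z‖ ≤ 154 * ε := by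
    rw [div_le_iff₀ hn0]
    have hε0 : 0 ≤ ε := by linarith [abs_nonneg z.im]
    nlinarith
  have hpi := Real.pi_lt_d2
  have h3 := mul_le_mul_of_nonneg_left h2 (le_of_lt (half_pos Real.pi_pos))
  have hε0 : 0 ≤ ε := by linarith [abs_nonneg z.im]
  nlinarith

/-- The targets `α = a/M` are within `1/300` of `7/16` once `M ≥ 300` and `|a − 7M/16| ≤ 1`. -/
theorem abs_target_sub_le {M c : ℕ} (hM : 300 ≤ M) (hc : |(c : ℝ) - 7 / 16 * M| ≤ 1) :
    |(c : ℝ) / M - 7 / 16| ≤ 1 / 300 := by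
  have hM0 : (0 : ℝ) < M := by exact_mod_cast (show 0 < M by omega)
  have hM300 : (300 : ℝ) ≤ M := by exact_mod_cast hM
  rw [show (c : ℝ) / M - 7 / 16 = ((c : ℝ) - 7 / 16 * M) / M by field_simp, abs_div, abs_of_pos hM0,
    div_le_iff₀ hM0]
  calc |(c : ℝ) - 7 / 16 * M| ≤ 1 := hc
    _ ≤ 1 / 300 * M := by linarith

/-- **K3b with explicit constants.**  For `ρ = 10⁻⁶`, `s = 1/20`, `S = 1/5`, `K = 16501`, `γ = ρ²/200`: given `τ₀` and
`0 < ε₁ ≤ min(τ₀/412, ρ²/1000)`, every `M ≥ 300`, filling numerators `a, b` within `1` of `7M/16` and analytic perturbation `h`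
bounded by `ε₁` on the annulus pair admit radii, base angles and a continuous exponent with clauses (i)–(iii) of
`stub_saddleGeometry`. -/
theorem saddle_geometry_core {τ₀ ε₁ : ℝ} (hε₁0 : 0 < ε₁) (hε₁τ : 412 * ε₁ ≤ τ₀)
    (hε₁ρ : ε₁ ≤ (1 / 1000000) ^ 2 / 1000) {M : ℕ} (hM : 300 ≤ M) {a b : ℕ} (ha : |(a : ℝ) - 7 / 16 * M| ≤ 1)
    (hb : |(b : ℝ) - 7 / 16 * M| ≤ 1) {h : ℂ × ℂ → ℂ}
    (hh : AnalyticOnNhd ℂ h ({ζ : ℂ | 2 / 3 < ‖ζ‖ ∧ ‖ζ‖ < 8 / 9} ×ˢ {ζ : ℂ | 2 / 3 < ‖ζ‖ ∧ ‖ζ‖ < 8 / 9}))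
    (hB : ∀ ζ ∈ ({ζ : ℂ | 2 / 3 < ‖ζ‖ ∧ ‖ζ‖ < 8 / 9} ×ˢ {ζ : ℂ | 2 / 3 < ‖ζ‖ ∧ ‖ζ‖ < 8 / 9}), ‖h ζ‖ ≤ ε₁) :
    ∃ r₁ r₂ : ℝ, 2 / 3 < r₁ ∧ r₁ < 8 / 9 ∧ 2 / 3 < r₂ ∧ r₂ < 8 / 9 ∧
      ∃ φ₀ ψ₀ : ℝ, ∃ Φ : ℝ → ℝ → ℂ, Continuous (Function.uncurry Φ) ∧
        (∀ φ ψ : ℝ,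
          (1 + (r₁ : ℂ) * cexp ((φ : ℂ) * I)) ^ M * (1 + (r₂ : ℂ) * cexp ((ψ : ℂ) * I)) ^ M *
              cexp ((M : ℂ) * h ((r₁ : ℂ) * cexp ((φ : ℂ) * I), (r₂ : ℂ) * cexp ((ψ : ℂ) * I))) /
            (((r₁ : ℂ) * cexp ((φ : ℂ) * I)) ^ a * ((r₂ : ℂ) * cexp ((ψ : ℂ) * I)) ^ b) =
          cexp ((M : ℂ) * Φ φ ψ)) ∧
        (∀ u v : ℝ, |u| ≤ 1 / 1000000 → |v| ≤ 1 / 1000000 →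
          (Φ (φ₀ + u) (ψ₀ + v) - Φ φ₀ ψ₀).re ≤ -(1 / 20) * (u ^ 2 + v ^ 2) ∧
          -(1 / 5) * (u ^ 2 + v ^ 2) ≤ (Φ (φ₀ + u) (ψ₀ + v) - Φ φ₀ ψ₀).re ∧
          |(Φ (φ₀ + u) (ψ₀ + v) - Φ φ₀ ψ₀).im| ≤ τ₀ * (u ^ 2 + v ^ 2) + 16501 * (|u| + |v|) ^ 3) ∧
        (∀ u v : ℝ, |u| ≤ Real.pi → |v| ≤ Real.pi → (1 / 1000000 ≤ |u| ∨ 1 / 1000000 ≤ |v|) →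
          (Φ (φ₀ + u) (ψ₀ + v) - Φ φ₀ ψ₀).re ≤ -((1 / 1000000) ^ 2 / 200)) := by
  have hMne : M ≠ 0 := by omega
  have hε28 : ε₁ ≤ 1 / 28000 := hε₁ρ.trans (by norm_num)
  have hα := abs_target_sub_le hM ha
  have hβ := abs_target_sub_le hM hb
  -- the base point `(z₀, w₀)` of part 5
  obtain ⟨⟨z₀, w₀⟩, hpD, e1, e2, -, -, hn1, hn2⟩ := exists_saddle_base_point hh hB hε28 _ _ hα hβ
  dsimp only at e1 e2 hn1 hn2
  obtain ⟨hzD, hwD⟩ := Set.mem_prod.mp hpD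
  rw [mem_closedBall, dist_eq_norm] at hzD hwD
  have hzr : ‖z₀ - (((a : ℝ) / M / (1 - (a : ℝ) / M) : ℝ) : ℂ)‖ ≤ 111 * ε₁ := hn1.trans (by linarith)
  have hwr : ‖w₀ - (((b : ℝ) / M / (1 - (b : ℝ) / M) : ℝ) : ℂ)‖ ≤ 111 * ε₁ := hn2.trans (by linarith)
  have hz13 : 13 / 18 ≤ ‖z₀‖ := by have := (norm_bounds_of_near_seven_ninths hzD).1; norm_num at this; exact this
  have hz15 : ‖z₀‖ ≤ 15 / 18 := by have := (norm_bounds_of_near_seven_ninths hzD).2; norm_num at this ⊢; exact this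
  have hw13 : 13 / 18 ≤ ‖w₀‖ := by have := (norm_bounds_of_near_seven_ninths hwD).1; norm_num at this; exact this
  have hw15 : ‖w₀‖ ≤ 15 / 18 := by have := (norm_bounds_of_near_seven_ninths hwD).2; norm_num at this ⊢; exact this
  -- polar coordinates of the base point
  obtain ⟨r₁, hr₁⟩ : ∃ r : ℝ, r = ‖z₀‖ := ⟨_, rfl⟩
  obtain ⟨r₂, hr₂⟩ : ∃ r : ℝ, r = ‖w₀‖ := ⟨_, rfl⟩
  obtain ⟨φ₀, hφ₀⟩ : ∃ φ : ℝ, φ = arg z₀ := ⟨_, rfl⟩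
  obtain ⟨ψ₀, hψ₀⟩ : ∃ ψ : ℝ, ψ = arg w₀ := ⟨_, rfl⟩
  have hzpol : (r₁ : ℂ) * cexp ((φ₀ : ℂ) * I) = z₀ := by rw [hr₁, hφ₀]; exact Complex.norm_mul_exp_arg_mul_I z₀
  have hwpol : (r₂ : ℂ) * cexp ((ψ₀ : ℂ) * I) = w₀ := by rw [hr₂, hψ₀]; exact Complex.norm_mul_exp_arg_mul_I w₀
  rw [← hr₁] at hz13 hz15
  rw [← hr₂] at hw13 hw15
  have htx : ∀ γ : ℝ, |γ - 7 / 16| ≤ 1 / 300 → 1 / 100 ≤ γ / (1 - γ) := by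
    intro γ hγ
    obtain ⟨h1, h2⟩ := abs_le.mp hγ
    rw [le_div_iff₀ (by linarith)]
    linarith
  have hφb : |φ₀| ≤ 250 * ε₁ := by rw [hφ₀]; exact abs_arg_le_of_near_real (htx _ hα) hε28 (hr₁ ▸ hz13) hzr
  have hψb : |ψ₀| ≤ 250 * ε₁ := by rw [hψ₀]; exact abs_arg_le_of_near_real (htx _ hβ) hε28 (hr₂ ▸ hw13) hwr
  -- the continuous exponent of part 2
  have hr₁0 : 0 < r₁ := by linarith
  have hr₁1 : r₁ < 1 := by linarith
  have hr₂0 : 0 < r₂ := by linarith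
  have hr₂1 : r₂ < 1 := by linarith
  have hcirc : Continuous fun p : ℝ × ℝ => ((r₁ : ℂ) * cexp ((p.1 : ℂ) * I), (r₂ : ℂ) * cexp ((p.2 : ℂ) * I)) := by
    fun_prop
  have hcont : Continuous fun p : ℝ × ℝ => h ((r₁ : ℂ) * cexp ((p.1 : ℂ) * I), (r₂ : ℂ) * cexp ((p.2 : ℂ) * I)) :=
    hh.continuousOn.comp_continuous hcirc
      (fun p => Set.mk_mem_prod (circle_mem_annulus hz13 hz15 p.1) (circle_mem_annulus hw13 hw15 p.2))
  obtain ⟨Φ, hΦc, hΦd, hΦe⟩ := exists_continuous_torus_exponent hMne a b hr₁0 hr₁1 hr₂0 hr₂1 h hcont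
  refine ⟨r₁, r₂, by linarith, by linarith, by linarith, by linarith, φ₀, ψ₀, Φ, hΦc,
    fun φ ψ => by rw [hΦd]; exact hΦe φ ψ, ?_, ?_⟩
  · -- clause (ii): the local bounds of part 7 at the base point
    intro u v hu hv
    have h1 : (r₁ : ℂ) * cexp (((φ₀ + u : ℝ) : ℂ) * I) = z₀ * cexp ((u : ℂ) * I) := by
      rw [← hzpol, Complex.ofReal_add, add_mul, Complex.exp_add]; ring
    have h2 : (r₂ : ℂ) * cexp (((ψ₀ + v : ℝ) : ℂ) * I) = w₀ * cexp ((v : ℂ) * I) := by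
      rw [← hwpol, Complex.ofReal_add, add_mul, Complex.exp_add]; ring
    have hGeq : Φ (φ₀ + u) (ψ₀ + v) - Φ φ₀ ψ₀ =
        Complex.log (1 + z₀ * cexp ((u : ℂ) * I)) - Complex.log (1 + z₀) +
          (Complex.log (1 + w₀ * cexp ((v : ℂ) * I)) - Complex.log (1 + w₀)) +
          (h (z₀ * cexp ((u : ℂ) * I), w₀ * cexp ((v : ℂ) * I)) - h (z₀, w₀)) -
          I * ((((a : ℝ) / M : ℝ) : ℂ) * u + (((b : ℝ) / M : ℝ) : ℂ) * v) := by
      rw [hΦd, hΦd, h1, h2, hzpol, hwpol]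
      push_cast
      ring
    obtain ⟨hup, hlo, him⟩ := saddle_local_bounds hh hB hε28 hzD hwD hα hβ e1 e2 hzr hwr
      (show (1 / 1000000 : ℝ) ≤ 1 / 40 by norm_num) hu hv _ hGeq
    have huu := sq_nonneg u
    have hvv := sq_nonneg v
    have hτ := mul_le_mul_of_nonneg_right hε₁τ (add_nonneg huu hvv)
    refine ⟨?_, ?_, ?_⟩
    · linarith
    · linarith
    · linarith
  · -- clause (iii): the global gap of part 8
    intro u v hu hv hfar
    have hGeq : Φ (φ₀ + u) (ψ₀ + v) - Φ φ₀ ψ₀ =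
        Complex.log (1 + (r₁ : ℂ) * cexp (((φ₀ + u : ℝ) : ℂ) * I)) - Complex.log (1 + (r₁ : ℂ) * cexp ((φ₀ : ℂ) * I)) +
          (Complex.log (1 + (r₂ : ℂ) * cexp (((ψ₀ + v : ℝ) : ℂ) * I)) -
            Complex.log (1 + (r₂ : ℂ) * cexp ((ψ₀ : ℂ) * I))) +
          (h ((r₁ : ℂ) * cexp (((φ₀ + u : ℝ) : ℂ) * I), (r₂ : ℂ) * cexp (((ψ₀ + v : ℝ) : ℂ) * I)) -
            h ((r₁ : ℂ) * cexp ((φ₀ : ℂ) * I), (r₂ : ℂ) * cexp ((ψ₀ : ℂ) * I))) -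
          I * ((((a : ℝ) / M : ℝ) : ℂ) * u + (((b : ℝ) / M : ℝ) : ℂ) * v) := by
      rw [hΦd, hΦd]
      push_cast
      ring
    have hpi := Real.pi_gt_three
    have key := saddle_global_bound hB hz13 hz15 hw13 hw15 (show (1 / 1000000 : ℝ) ≤ Real.pi by linarith)
      (show |φ₀| ≤ 1 / 1000000 / 2 by linarith) (show |ψ₀| ≤ 1 / 1000000 / 2 by linarith) hu hv hfar _ hGeq
    have hφ2 : φ₀ ^ 2 ≤ (250 * ε₁) ^ 2 := by rw [← sq_abs φ₀]; exact pow_le_pow_left₀ (abs_nonneg _) hφb 2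
    have hψ2 : ψ₀ ^ 2 ≤ (250 * ε₁) ^ 2 := by rw [← sq_abs ψ₀]; exact pow_le_pow_left₀ (abs_nonneg _) hψb 2
    have hε2 : ε₁ ^ 2 ≤ (1 / 1000000) ^ 2 / 1000 * ε₁ := by
      rw [sq]; exact mul_le_mul_of_nonneg_right hε₁ρ hε₁0.le
    linarith

/-- **K3b `stub_saddleGeometry` of line `zerofree_corridor` v8** (saddle geometry of the exponent on the fugacity torus), with the
annulus `fugAnnulus = {2/3 < |ζ| < 8/9}` spelled out: assembled from parts 1–8 via `saddle_geometry_core` with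
`ρ = 10⁻⁶`, `s = 1/20`, `S = 1/5`, `K = 16501`, `γ = ρ²/200`, `ε₁ = min(τ₀/412, ρ²/1000)`, `M₁ = 300`. -/
theorem saddle_geometry :
    ∃ ρ s S K γ : ℝ, 0 < ρ ∧ 0 < s ∧ 0 < S ∧ 0 ≤ K ∧ 0 < γ ∧ ρ ≤ Real.pi ∧
      ∀ τ₀ : ℝ, 0 < τ₀ → ∃ ε₁ : ℝ, 0 < ε₁ ∧ ∃ M₁ : ℕ, ∀ M : ℕ, M₁ ≤ M →
        ∀ a b : ℕ, |(a : ℝ) - 7 / 16 * M| ≤ 1 → |(b : ℝ) - 7 / 16 * M| ≤ 1 →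
          ∀ h : ℂ × ℂ → ℂ,
            AnalyticOnNhd ℂ h ({ζ : ℂ | 2 / 3 < ‖ζ‖ ∧ ‖ζ‖ < 8 / 9} ×ˢ {ζ : ℂ | 2 / 3 < ‖ζ‖ ∧ ‖ζ‖ < 8 / 9}) →
            (∀ ζ ∈ ({ζ : ℂ | 2 / 3 < ‖ζ‖ ∧ ‖ζ‖ < 8 / 9} ×ˢ {ζ : ℂ | 2 / 3 < ‖ζ‖ ∧ ‖ζ‖ < 8 / 9}), ‖h ζ‖ ≤ ε₁) →
            ∃ r₁ r₂ : ℝ, 2 / 3 < r₁ ∧ r₁ < 8 / 9 ∧ 2 / 3 < r₂ ∧ r₂ < 8 / 9 ∧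
              ∃ φ₀ ψ₀ : ℝ, ∃ Φ : ℝ → ℝ → ℂ, Continuous (Function.uncurry Φ) ∧
                (∀ φ ψ : ℝ,
                  (1 + (r₁ : ℂ) * cexp ((φ : ℂ) * I)) ^ M * (1 + (r₂ : ℂ) * cexp ((ψ : ℂ) * I)) ^ M *
                      cexp ((M : ℂ) * h ((r₁ : ℂ) * cexp ((φ : ℂ) * I), (r₂ : ℂ) * cexp ((ψ : ℂ) * I))) /
                    (((r₁ : ℂ) * cexp ((φ : ℂ) * I)) ^ a * ((r₂ : ℂ) * cexp ((ψ : ℂ) * I)) ^ b) =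
                  cexp ((M : ℂ) * Φ φ ψ)) ∧
                (∀ u v : ℝ, |u| ≤ ρ → |v| ≤ ρ →
                  (Φ (φ₀ + u) (ψ₀ + v) - Φ φ₀ ψ₀).re ≤ -s * (u ^ 2 + v ^ 2) ∧
                  -S * (u ^ 2 + v ^ 2) ≤ (Φ (φ₀ + u) (ψ₀ + v) - Φ φ₀ ψ₀).re ∧
                  |(Φ (φ₀ + u) (ψ₀ + v) - Φ φ₀ ψ₀).im| ≤ τ₀ * (u ^ 2 + v ^ 2) + K * (|u| + |v|) ^ 3) ∧
                (∀ u v : ℝ, |u| ≤ Real.pi → |v| ≤ Real.pi → (ρ ≤ |u| ∨ ρ ≤ |v|) →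
                  (Φ (φ₀ + u) (ψ₀ + v) - Φ φ₀ ψ₀).re ≤ -γ) := by
  refine ⟨1 / 1000000, 1 / 20, 1 / 5, 16501, (1 / 1000000) ^ 2 / 200, by norm_num, by norm_num, by norm_num,
    by norm_num, by norm_num, by have := Real.pi_gt_three; linarith, ?_⟩
  intro τ₀ hτ₀
  refine ⟨min (τ₀ / 412) ((1 / 1000000) ^ 2 / 1000), lt_min (by positivity) (by norm_num), 300, ?_⟩
  intro M hM a b ha hb h hh hB
  exact saddle_geometry_core (lt_min (by positivity) (by norm_num))
    (by linarith [min_le_left (τ₀ / 412) ((1 / 1000000) ^ 2 / 1000)]) (min_le_right _ _) hM ha hb hh hB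

end Summit.Ventures.CertifiedManyBodySolver.Theorems.TcThermcert1.ZeroFreeCorridor

end
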